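import Mathlib
import HarnessLib
import Literature.MathematicalPhysics.QuantumFieldTheory.ConstructiveQFTWave0
import Literature.MathematicalPhysics.QuantumFieldTheory.Luscher2010.FlowActionSeries
import Summits.Ventures.LatticeQCDFlow.Exactness.LatticeCoordAvg
import Summits.Ventures.LatticeQCDFlow.Scaling.AutoregressiveGaugeRedundancy

/-!
# LatticeQCDFlow / Scaling — gauge redundancy of the autoregressive context, II: the Wilson witness
# (a plaquette-mate outside the context; C5 fails for gauge links) and the conditional-expectation
# certificate of the partial Haar marginal

HONEST FRAMING: exact (Metropolis-corrected) sampling algorithms for lattice gauge theory;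
figures of merit are autocorrelation/cost numbers at stated couplings and volumes; no
continuum-physics claim.

Venture `LatticeQCDFlow` (cell pub-lqcd), topic `Scaling`, FANOUT row 30 (lean-1, GEN-15) — OUR WORK,
sequel of `Scaling/AutoregressiveGaugeRedundancy.lean` (the mechanism: partial Haar marginals
`A_s F = Exactness.coordAvg (haarProbability G) s F` of gauge-invariant weights are gauge invariant;
a link BURIED by the integrated set `s` drops out of `A_s F`; the exact autoregressive conditional of
the next link `a`, `A_s F / A_{insert a s} F`, does not read buried generated links).  THEORY-2.md §4
row C5 asks whether, for the Wilson action, the exact autoregressive context of every link is EXACTLY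
its symbolic context (fill neighbourhood in the plaquette-sharing graph of the links, tree
`Luscher2010.plaqNbhd`), "as for generic Gaussians".  This file answers NO, in link variables:

* §4 THE WITNESS — every compact `G`, every representation `ρ`, every real `β`, every `d`, every
  `L ≥ 2`, every site `x`, every pair of directions `i ≠ j`.  `ℓ = (x, i)`, `a = (x + e_j, i)`,
  `b = (x, j)` are links of ONE plaquette (`plaquetteHolonomy_eq_mates`; `mem_plaqNbhd_mate`: `ℓ` is a
  NEIGHBOUR of `a` in the plaquette-sharing graph); `s = star(x) ∖ {ℓ}` (the other `2d − 1` links at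
  `x`) contains `b`, not `a`, not `ℓ`.  **`wilson_arConditional_plaquetteMate_dropout`**: the exact
  conditional density of `U_a` given the links off `insert a s` — its plaquette-mate `U_ℓ` among them —
  `A_s w / A_{insert a s} w` with `w = e^{−β S_W}`, takes the same value at `U` and at `U[ℓ ↦ h]` for
  every `h : G`.  In every linear order that generates `ℓ` before `a` and `star(x) ∖ {ℓ}` after `a`,
  `ℓ` is a higher neighbour of `a`, hence in the symbolic context `adj⁺_*(a)` of EVERY such order
  (tree `EliminationGraph`: neighbours above are fill-neighbours) — and not in the true context.
  `wilson_coordAvg_update_of_star_subset`: the same for any link at a site whose other links are all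
  still to be generated.
* §5 THE CERTIFICATE that `A_s F` IS the conditional expectation given the links off `s` under a
  product probability measure, in the plain measurable/bounded setting of gauge theory (the tree's
  `Exactness.integral_sub_coordAvg_mul_eq_zero` assumes a compact METRIC factor and continuity):
  **`integral_mul_coordAvg_eq`** `∫ Φ·F d(⊗μ) = ∫ Φ·(A_s F) d(⊗μ)` for bounded measurable `F`, `Φ` with
  `Φ` blind to the links of `s` (gluing two independent samples along `s` is measure preserving,
  tree `map_piecewise_pi_prod`, + Fubini); `integral_coordAvg_eq` (total mass).  Consequently, under
  the normalised weight `F·⊗Haar / ∫F`, the links off `s` have density `A_s F / ∫F` against `⊗Haar`,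
  and the conditional density of `U_a` given the links off `insert a s` is `A_s F / A_{insert a s} F` —
  the object of §4 and of the mechanism file.

READING (value-free, for THEORY-2 §4 C5 / T2-AF (a)): C5 AS WORDED IS FALSE FOR THE WILSON ACTION IN
LINK VARIABLES, for every compact gauge group, representation and coupling: gauge redundancy removes
links — here a plaquette-mate — from exact autoregressive contexts that the plaquette-sharing graph
(and C5's "generic Gaussian" heuristic) puts in.  Repair: state faithfulness MODULO GAUGE (in a
maximal-tree / axial gauge, or in plaquette variables with Bianchi constraints); the free field of
GEN-14 (`AutoregressiveContextLaw`) is the faithful case proved; in the gauge case in `d = 2` the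
plaquette variables off one puncture are exactly i.i.d. Haar under product Haar measure (GEN-5
`PlaquetteMarginals2D`), so the gauge-reduced interaction is one global constraint; the gauge-reduced
context in `d ≥ 3` is OPEN (no number claimed).  The companion
`Scaling/AutoregressiveGaugeRedundancyMatching.lean` shows the gap symbolic-minus-true context can be
of the order of the VOLUME (links generated along a matching are invisible and the next link is
exactly Haar).  NOT CLAIMED: that the Wilson weight reads `U_ℓ` before marginalisation in
a quantified sense (it does as soon as `β ≠ 0` and `Re tr ρ` is not constant — the shared plaquette
couples `U_ℓ` and `U_a` — but only the graph-theoretic certificate `mem_plaqNbhd_mate` is typed here);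
faithfulness for `φ⁴`; anything about approximate samplers or about any number of ours.  Elementary
over the tree; no definition is introduced; nothing is cited as a fact; no `sorry`.
-/

noncomputable section

namespace Summit.Ventures.LatticeQCDFlow.Theory2.Autoregressive

open MeasureTheory Function
open Literature.MathematicalPhysics.QuantumFieldTheory
open Summit.Ventures.LatticeQCDFlow.Exactness

variable {d L N : ℕ} {G : Type*} [Group G]

/-! ## §4 The Wilson witness: a plaquette-mate outside the context -/

section Wilson

variable (ρ : G →* Matrix (Fin N) (Fin N) ℂ)

/-- The Wilson weight `e^{−β S_W}` is gauge invariant (tree `wilsonAction_gaugeTransform`). [ours] -/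
theorem isGaugeInvariant_wilsonWeightFun [NeZero L] (β : ℝ) :
    IsGaugeInvariant (fun U : GaugeConfig d L G => Real.exp (-β * wilsonAction ρ U)) :=
  fun γ U => by simp only [wilsonAction_gaugeTransform]

/-- The three links `ℓ = (x, i)`, `a = (x + e_j, i)`, `b = (x, j)` are PLAQUETTE-MATES: the
holonomy of the plaquette at `x` in the `(i, j)` plane is `U_ℓ · U_{(x+e_i, j)} · U_a⁻¹ · U_b⁻¹`.
[ours] -/
theorem plaquetteHolonomy_eq_mates (U : GaugeConfig d L G) (x : Site d L) (i j : Fin d) :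
    plaquetteHolonomy U x i j = U (x, i) * U (x.shift i, j) * (U (x.shift j, i))⁻¹ * (U (x, j))⁻¹ :=
  rfl

/-- **`ℓ = (x, i)` is a neighbour of `a = (x + e_j, i)` in the plaquette-sharing graph of the links**
(`i ≠ j`; the tree's `Luscher2010.plaqNbhd`, the adjacency behind `linkBall` / the locality of flows):
both lie on the plaquette at `x` in the `(i, j)` plane.  So `ℓ` is in the SYMBOLIC autoregressive
context of `a` in every order generating `ℓ` before `a`. [ours] -/
theorem mem_plaqNbhd_mate (x : Site d L) {i j : Fin d} (hij : i ≠ j) :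
    ((x, i) : Edge d L) ∈ Luscher2010.plaqNbhd ((x.shift j, i) : Edge d L) :=
  ⟨x, i, j, hij, by simp [Luscher2010.plaqLinks], by simp [Luscher2010.plaqLinks]⟩

/-- `b = (x, j)` is a plaquette-sharing neighbour of `a = (x + e_j, i)` as well (`i ≠ j`). [ours] -/
theorem mem_plaqNbhd_mate' (x : Site d L) {i j : Fin d} (hij : i ≠ j) :
    ((x, j) : Edge d L) ∈ Luscher2010.plaqNbhd ((x.shift j, i) : Edge d L) :=
  ⟨x, i, j, hij, by simp [Luscher2010.plaqLinks], by simp [Luscher2010.plaqLinks]⟩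

/-- For `L ≥ 2` a shifted site differs from the site: `x + e_i ≠ x`. [ours] -/
private theorem Site.shift_ne_self (hL : 2 ≤ L) (x : Site d L) (i : Fin d) : x.shift i ≠ x := by
  haveI : Fact (1 < L) := ⟨hL⟩
  intro h
  have h1 : (x.shift i) i = x i := by rw [h]
  simp [Site.shift] at h1

/-- For `L ≥ 2` and `i ≠ j`: `x + e_j + e_i ≠ x`. [ours] -/
private theorem Site.shift_shift_ne_self (hL : 2 ≤ L) (x : Site d L) {i j : Fin d} (hij : i ≠ j) :
    (x.shift j).shift i ≠ x := by
  haveI : Fact (1 < L) := ⟨hL⟩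
  intro h
  have h1 : ((x.shift j).shift i) i = x i := by rw [h]
  simp [Site.shift, hij] at h1

variable [TopologicalSpace G] [IsTopologicalGroup G] [CompactSpace G] [MeasurableSpace G]
  [BorelSpace G]

/-- **THE WITNESS.**  Every compact `G`, every representation `ρ`, every real `β`, every `d`, every
`L ≥ 2`, every site `x`, every pair of directions `i ≠ j`.  Put `ℓ = (x, i)`, `a = (x + e_j, i)`,
`b = (x, j)` (plaquette-mates, `plaquetteHolonomy_eq_mates`, `mem_plaqNbhd_mate`) and let `s` be the
set of links incident to `x` other than `ℓ` (`b ∈ s`, `a ∉ s`, `ℓ ∉ s`).  Then the exact conditional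
density of `U_a` given the links off `insert a s` — `U_ℓ` among them — built from the Wilson weight
`w = e^{−β S_W}`, `A_s w / A_{insert a s} w`, takes the same value at `U` and at `U[ℓ ↦ h]` for every
`h`: in any order generating `ℓ` before `a` and `star(x) ∖ {ℓ}` after `a`, the plaquette-mate `ℓ` is
in the SYMBOLIC context of `a` and not in its true context.  C5 as worded fails for the Wilson action
in link variables. [ours] -/
theorem wilson_arConditional_plaquetteMate_dropout [NeZero L] (hL : 2 ≤ L) (β : ℝ) (x : Site d L)
    {i j : Fin d} (hij : i ≠ j) (U : GaugeConfig d L G) (h : G) :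
    let w : GaugeConfig d L G → ℝ := fun U => Real.exp (-β * wilsonAction ρ U)
    let ℓ : Edge d L := (x, i)
    let a : Edge d L := (x.shift j, i)
    let s : Finset (Edge d L) :=
      (Finset.univ.filter fun e : Edge d L => e.1 = x ∨ e.1.shift e.2 = x).erase ℓ
    (x, j) ∈ s ∧ a ∉ s ∧ ℓ ∉ s ∧
      coordAvg (haarProbability G) s w (update U ℓ h) /
          coordAvg (haarProbability G) (insert a s) w (update U ℓ h) =
        coordAvg (haarProbability G) s w U / coordAvg (haarProbability G) (insert a s) w U := by
  intro w ℓ a s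
  have ha : ¬ (a.1 = x ∨ a.1.shift a.2 = x) := by
    rintro (h1 | h2)
    · exact Site.shift_ne_self hL x j h1
    · exact Site.shift_shift_ne_self hL x hij h2
  refine ⟨?_, ?_, ?_, ?_⟩
  · refine Finset.mem_erase.2 ⟨?_, Finset.mem_filter.2 ⟨Finset.mem_univ _, Or.inl rfl⟩⟩
    intro hb
    exact hij (congrArg Prod.snd hb).symm
  · intro has
    exact ha (Finset.mem_filter.1 (Finset.mem_of_mem_erase has)).2
  · exact Finset.notMem_erase ℓ _
  · refine arConditional_update_of_buried (isGaugeInvariant_wilsonWeightFun ρ β) (x := x) a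
      (Or.inl rfl) (Site.shift_ne_self hL x i).symm ?_ U h
    intro e he hne
    exact Finset.mem_erase.2 ⟨hne, Finset.mem_filter.2 ⟨Finset.mem_univ _, he⟩⟩

/-- The un-normalised form of the witness: the two Wilson marginals `A_s w`, `A_{insert a s} w`
are separately blind to the plaquette-mate `ℓ` (here for any `j`). [ours] -/
theorem wilson_arMarginals_plaquetteMate_dropout [NeZero L] (hL : 2 ≤ L) (β : ℝ) (x : Site d L)
    (i j : Fin d) (U : GaugeConfig d L G) (h : G) :
    let w : GaugeConfig d L G → ℝ := fun U => Real.exp (-β * wilsonAction ρ U)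
    let ℓ : Edge d L := (x, i)
    let a : Edge d L := (x.shift j, i)
    let s : Finset (Edge d L) :=
      (Finset.univ.filter fun e : Edge d L => e.1 = x ∨ e.1.shift e.2 = x).erase ℓ
    coordAvg (haarProbability G) s w (update U ℓ h) = coordAvg (haarProbability G) s w U ∧
      coordAvg (haarProbability G) (insert a s) w (update U ℓ h) =
        coordAvg (haarProbability G) (insert a s) w U := by
  intro w ℓ a s
  refine arMarginals_update_of_buried (isGaugeInvariant_wilsonWeightFun ρ β) (x := x) a
    (Or.inl rfl) (Site.shift_ne_self hL x i).symm ?_ U h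
  intro e he hne
  exact Finset.mem_erase.2 ⟨hne, Finset.mem_filter.2 ⟨Finset.mem_univ _, he⟩⟩

/-- **Every link at a fully integrated site drops out** (the same burial, stated for the WHOLE star):
if all links at `x` but `ℓ` are still to be generated (`⊆ s`), the Wilson marginal `A_s w` is blind to
`U_ℓ` — for every later link's conditional at once (`L ≥ 2`, so that `ℓ` is not a loop). [ours] -/
theorem wilson_coordAvg_update_of_star_subset [NeZero L] (hL : 2 ≤ L) (β : ℝ) {s : Finset (Edge d L)}
    {x : Site d L} {ℓ : Edge d L} (hinc : ℓ.1 = x ∨ ℓ.1.shift ℓ.2 = x)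
    (hstar : ∀ e : Edge d L, e.1 = x ∨ e.1.shift e.2 = x → e ≠ ℓ → e ∈ s)
    (U : GaugeConfig d L G) (h : G) :
    coordAvg (haarProbability G) s (fun U => Real.exp (-β * wilsonAction ρ U)) (update U ℓ h) =
      coordAvg (haarProbability G) s (fun U => Real.exp (-β * wilsonAction ρ U)) U :=
  coordAvg_update_of_buried (isGaugeInvariant_wilsonWeightFun ρ β) hinc
    (Site.shift_ne_self hL ℓ.1 ℓ.2).symm hstar U h

end Wilson

/-! ## §5 The partial Haar marginal is the conditional expectation given the links off `s` -/

section Certificate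

variable [MeasurableSpace G] (μ : Measure G) [IsProbabilityMeasure μ]

omit [Group G] in
/-- **`A_s F` is the conditional expectation of `F` given the links off `s`** (product of copies of a
probability measure `μ` on `G`, e.g. Haar): for bounded measurable `F` and bounded measurable `Φ`
blind to the links of `s`, `∫ Φ·F d(⊗μ) = ∫ Φ·(A_s F) d(⊗μ)`.  Proof: gluing two independent
`⊗μ`-samples along `s` is measure preserving (tree `map_piecewise_pi_prod`), then Fubini.
Consequently, under the normalised weight `F·⊗μ/∫F`, the links off `s` have density `A_s F/∫F`
against `⊗μ`, and the conditional density of `U_a` given the links off `insert a s` is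
`A_s F / A_{insert a s} F`. [ours] -/
theorem integral_mul_coordAvg_eq [NeZero L] (s : Finset (Edge d L)) {F Φ : GaugeConfig d L G → ℝ}
    (hF : Measurable F) (hFb : ∃ C, ∀ U, |F U| ≤ C) (hΦ : Measurable Φ) (hΦb : ∃ C, ∀ U, |Φ U| ≤ C)
    (hΦs : ∀ U V, Φ (s.piecewise V U) = Φ U) :
    ∫ U, Φ U * F U ∂Measure.pi (fun _ : Edge d L => μ) =
      ∫ U, Φ U * coordAvg μ s F U ∂Measure.pi (fun _ : Edge d L => μ) := by
  obtain ⟨CF, hCF⟩ := hFb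
  obtain ⟨CΦ, hCΦ⟩ := hΦb
  -- the glued integrand on the product space
  have hglue : Measurable fun p : GaugeConfig d L G × GaugeConfig d L G => s.piecewise p.2 p.1 :=
    measurable_piecewise_prod s
  have hint : Integrable (fun p : GaugeConfig d L G × GaugeConfig d L G =>
      Φ (s.piecewise p.2 p.1) * F (s.piecewise p.2 p.1))
      ((Measure.pi (fun _ : Edge d L => μ)).prod (Measure.pi (fun _ : Edge d L => μ))) := by
    refine Integrable.mono' (integrable_const (CΦ * CF)) ?_ (ae_of_all _ fun p => ?_)
    · exact ((hΦ.comp hglue).mul (hF.comp hglue)).aestronglyMeasurable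
    · rw [Real.norm_eq_abs, abs_mul]
      exact mul_le_mul (hCΦ (s.piecewise p.2 p.1)) (hCF (s.piecewise p.2 p.1)) (abs_nonneg _)
        ((abs_nonneg (Φ (s.piecewise p.2 p.1))).trans (hCΦ _))
  -- left side through the gluing map
  have hL : ∫ U, Φ U * F U ∂Measure.pi (fun _ : Edge d L => μ) =
      ∫ p, Φ (s.piecewise p.2 p.1) * F (s.piecewise p.2 p.1)
        ∂((Measure.pi (fun _ : Edge d L => μ)).prod (Measure.pi (fun _ : Edge d L => μ))) := by
    have hm : AEStronglyMeasurable (fun U : GaugeConfig d L G => Φ U * F U)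
        (Measure.map (fun p : GaugeConfig d L G × GaugeConfig d L G => s.piecewise p.2 p.1)
          ((Measure.pi (fun _ : Edge d L => μ)).prod (Measure.pi (fun _ : Edge d L => μ)))) :=
      (Measurable.mul hΦ hF).aestronglyMeasurable
    conv_lhs => rw [← map_piecewise_pi_prod μ s]
    rw [integral_map (f := fun U : GaugeConfig d L G => Φ U * F U) hglue.aemeasurable hm]
  rw [hL, integral_prod _ hint]
  refine integral_congr_ae (ae_of_all _ fun U => ?_)
  simp only [hΦs]
  rw [integral_const_mul]
  rfl

omit [Group G] in
/-- The same with the factors swapped: `∫ F·Φ = ∫ (A_s F)·Φ`. [ours] -/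
theorem integral_coordAvg_mul_eq [NeZero L] (s : Finset (Edge d L)) {F Φ : GaugeConfig d L G → ℝ}
    (hF : Measurable F) (hFb : ∃ C, ∀ U, |F U| ≤ C) (hΦ : Measurable Φ) (hΦb : ∃ C, ∀ U, |Φ U| ≤ C)
    (hΦs : ∀ U V, Φ (s.piecewise V U) = Φ U) :
    ∫ U, F U * Φ U ∂Measure.pi (fun _ : Edge d L => μ) =
      ∫ U, coordAvg μ s F U * Φ U ∂Measure.pi (fun _ : Edge d L => μ) := by
  simp_rw [mul_comm (F _), mul_comm (coordAvg μ s F _)]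
  exact integral_mul_coordAvg_eq μ s hF hFb hΦ hΦb hΦs

omit [Group G] in
/-- **Total mass**: `∫ A_s F d(⊗μ) = ∫ F d(⊗μ)` for bounded measurable `F` (take `Φ = 1`). [ours] -/
theorem integral_coordAvg_eq [NeZero L] (s : Finset (Edge d L)) {F : GaugeConfig d L G → ℝ}
    (hF : Measurable F) (hFb : ∃ C, ∀ U, |F U| ≤ C) :
    ∫ U, coordAvg μ s F U ∂Measure.pi (fun _ : Edge d L => μ) =
      ∫ U, F U ∂Measure.pi (fun _ : Edge d L => μ) := by
  have h := integral_mul_coordAvg_eq μ s hF hFb (Φ := fun _ => (1 : ℝ)) measurable_const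
    ⟨1, fun _ => by simp⟩ (fun _ _ => rfl)
  simpa using h.symm

end Certificate

end Summit.Ventures.LatticeQCDFlow.Theory2.Autoregressive

end
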